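import Summits.ABC.StewartYu.PadicG3TwoThirdStepR
import Summits.ABC.StewartYu.PadicG3TwoThirdSizesSat
import Summits.ABC.StewartYu.PadicG3TwoMainChainSat
import HarnessLib

/-!
# Cell abc-stewartyu, WP-L.P(2) (crux r4 `PadicCoreTwoRat`, stmt-ABC-20504), layer K3b: the THIRD STEP of the level
# induction on the 𝔑-THREADED family — `ThirdStepTwo σ (ShSat F Bv Sh) I` from the record's Sat-numerics, the
# assembler's basis step (v2, base-relative re-indexing) and the `3`-Kummer condition on the generators `ϑ`

`Summits/ABC/StewartYu/PadicG3TwoThirdStepSat.lean` — cell `abc-stewartyu` (HOME `run/shared/lean/pub/abc-stewartyu/`),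
route `YuMatveevShapeRat`, seat p3 (g9, WP-L.P(2) lead; design memo HOME/p3/memo-11 §2 rows «third step», §4 K3).  Two
definitions (the Sat class-vector denominator/size in the schedule's letters), one `Prop`-structure and theorems; no named
fact.  Twin of p5's `PadicG3TwoThirdStepR` (v2 = BASE-RELATIVE re-indexing `κ′ = (κ − κ_{i₁})/3`, the design of record:
with it the virtual box of level `I` is `2·Bv₀/3^I`, no floor — print's `λ̄ = 𝐥 − 𝐯ₛ`, Nesterenko (4.35)).

* `thirdDenSat σ F Bv Ucol I s τ = den₀(I+1)(s,τ)·|b_θ|^{|t|}·DmOf(W3 (Bv I) Ucol s)`, `thirdMSat` — the class vector's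
  denominator and size with the VIRTUAL clearing of `qPart3` (`PadicG3TwoThirdSizesSat`);
* `ThirdFinalTwoRSat σ F Bv Ucol I` — `ThirdFinalTwoR` with the third-step inequality against `thirdDenSat`/`thirdMSat`;
* **`thirdVec_eq_zero_of_admRSat`** — all triadic class sums vanish at the new nodes (multicubic Liouville
  `thirdVec_eq_zero_of_zeros` UNMODIFIED, sizes from the virtual box read off `ShSat` and the basis slot `Σₖ|U k j| ≤ Ucolⱼ`);
* `adm_reindex3RSat` — admissibility of the base-relative re-indexed class at level `I + 1` (the landed proof, generic in
  the shape slot);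
* **`thirdStepTwo_ofRSat`** — `ThirdStepTwo σ (ShSat F Bv Sh) I`.

WHAT THIS IS NOT: no basis step instance (sequel: the Fel'dman-basis × C-image family), no numbers; no crux moves.

References: K. Yu, Acta Math. 211 (2013), Lemmas 5.3–5.4 (5.50)–(5.70); Yu. V. Nesterenko, LNM 1819 (2003), §4.3
(4.35)–(4.51); HOME/p3/memo-11 §2, §4.
-/

noncomputable section

open Finset Polynomial
open scoped Matrix
open Literature.NumberTheory.Transcendental
open Literature.NumberTheory.Transcendental.CW77 (heightProd)
open Literature.NumberTheory.Transcendental.CW77.Setup (Tau tauNorm)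
open Literature.NumberTheory.Transcendental.PadicCW77 (condExp)

namespace Summit.ABC.StewartYu

namespace TwoSetup

variable {S : TwoSetup} {ι : Type*} (σ : S.G3TwoSched) (F : S.SatData) (Bv : ℕ → Fin (S.d + 1) → ℕ)
  (Ucol : Fin (S.d + 1) → ℕ) (Sh : ℕ → S.G3Fam ι → Prop)

/-! ### The record's obligations (Sat) -/

/-- **The denominator of the class vector at `(s, τ)` on the 𝔑-threaded family**:
`den₀(I+1)(s,τ)·|b_θ|^{|t|}·DmOf(W3 (Bv I) Ucol s)`. [cite: Yu2013, (5.35); shape only] -/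
def thirdDenSat (I : ℕ) (s : ℤ) (τ : Tau S.d) : ℕ :=
  σ.den₀ (I + 1) s τ * S.bθ.natAbs ^ (∑ j, τ.2 j) * F.DmOf (SatData.W3 (Bv I) Ucol s)

/-- **The size of the class vector at `(s, τ)` on the 𝔑-threaded family**:
`max 1 (cardB I·P·(3^{t₀}·M₀(I+1)(s,τ)·Xb I^{|t|}·DmOf(W3 (Bv I) Ucol s)²))`. [cite: Yu2013, (5.38); shape only] -/
def thirdMSat (I : ℕ) (s : ℤ) (τ : Tau S.d) : ℝ :=
  max 1 ((σ.cardB I : ℝ) * σ.P * ((3 : ℝ) ^ τ.1 * σ.M₀ (I + 1) s τ * (σ.Xb I : ℝ) ^ (∑ j, τ.2 j) *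
    ((F.DmOf (SatData.W3 (Bv I) Ucol s) : ℝ)) ^ 2))

/-- **THE RECORD'S OBLIGATIONS FOR THE THIRD STEP `I → I + 1` ON THE 𝔑-THREADED FAMILY** (= `ThirdFinalTwoR` with the
third-step inequality against `thirdDenSat`/`thirdMSat`). [cite: Yu2013, Lemma 5.4 (5.58)–(5.70); shape only] -/
structure ThirdFinalTwoRSat (I : ℕ) : Prop where
  /-- the multiplicity spent at the third points -/
  tthird_pos : 1 ≤ σ.Tfin I - σ.T0 (I + 1)
  /-- order budget -/
  T0_succ_le : σ.T0 (I + 1) ≤ σ.Tfin I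
  /-- family size slot is monotone -/
  cardB_mono : σ.cardB I ≤ σ.cardB (I + 1)
  /-- weighted coefficient slot is monotone -/
  Bw_mono : σ.Bw I ≤ σ.Bw (I + 1)
  /-- the new directional bound -/
  Xb_succ : ∀ j, |S.bθ| * (σ.Dbox (I + 1) j : ℤ) + |S.b j| * (σ.Dθ (I + 1) : ℤ) ≤ σ.Xb (I + 1)
  /-- positive `Y₀`-weight denominators at the next level -/
  one_le_den₀ : ∀ (x : ℤ) (τ : Tau S.d), 1 ≤ σ.den₀ (I + 1) x τ
  /-- the third-step inequality at every new node -/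
  hfinal : ∀ s : ℤ, |s| ≤ (σ.N0 (I + 1) : ℤ) → ¬ (3 : ℤ) ∣ s → ∀ τ : Tau S.d, tauNorm τ < σ.T0 (I + 1) →
    max (σ.Bw I * ‖S.Λ₀‖ * (2 : ℝ) ^ (σ.Tfin I - σ.T0 (I + 1)) *
          (2 : ℝ) ^ condExp 2 (2 * σ.Nfin I + 1) (σ.Tfin I - σ.T0 (I + 1)))
        (σ.Bw I / (4 * (2 : ℝ) ^ σ.m) ^ ((2 * σ.Nfin I + 1) * (σ.Tfin I - σ.T0 (I + 1)))) <
      1 / (6 * (thirdDenSat σ F Bv Ucol I s τ : ℝ) * thirdMSat σ F Bv Ucol I s τ * heightProd S.toQ.all ^ 5) ^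
        (3 ^ (S.d + 1 + 1) - 1)

/-! ### The class sums vanish at the new nodes -/

/-- **All triadic class sums vanish** at `|s| ≤ N0 (I+1)`, `3 ∤ s`, `|τ| < T0 (I+1)`, for an admissible level-`I`
family of the 𝔑-threaded frame vanishing at all `|x| ≤ Nfin I`, `|τ| < Tfin I` (basis slot `Σₖ |U k j| ≤ Ucolⱼ`).
[cite: Yu2013, Lemmas 5.3–5.4] [cite: Nesterenko2003, §4.3 (4.45)–(4.51)] -/
theorem thirdVec_eq_zero_of_admRSat {I : ℕ} (hfin : ThirdFinalTwoRSat σ F Bv Ucol I)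
    (hbs : BasisStepTwoR σ (ShSat F Bv Sh) I) (hUcol : ∀ j, ∑ k, |F.U k j| ≤ (Ucol j : ℤ))
    (hK : ∀ κ : Fin (S.d + 1) → ℕ, (∃ j, ¬ 3 ∣ κ j) → ∀ γ : ℚ, ∏ j, S.toQ.all j ^ κ j ≠ γ ^ 3)
    {Λ : S.G3Fam ι} (hadm : S.G3Adm σ (ShSat F Bv Sh) I Λ) (hvan : Λ.vanish nodesAll (σ.Nfin I) (σ.Tfin I)) :
    ∀ s : ℤ, |s| ≤ (σ.N0 (I + 1) : ℤ) → ¬ (3 : ℤ) ∣ s → ∀ τ : Tau S.d, tauNorm τ < σ.T0 (I + 1) →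
      S.thirdVec Λ.R Λ.u Λ.uθ Λ.B Λ.p τ s = 0 := by
  intro s hs h3 τ hτ
  obtain ⟨i, hi, _⟩ := hadm.exists_ne
  have hvbox := vbox_of_adm σ F Bv Sh hadm
  have hBw0 : 0 ≤ σ.Bw I := by
    have h := hadm.wt i hi 0 0
    rw [pow_zero, mul_one] at h
    exact (norm_nonneg _).trans h
  -- third-point weight data from the next level's data for `R ∘ (Y₀/3)`
  have hR3 : ∀ i ∈ Λ.B, ∃ z₀ : ℤ, (σ.den₀ (I + 1) s τ : ℚ) * (hasseDeriv τ.1 (Λ.R i)).eval ((s : ℚ) / 3) = z₀ ∧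
      |z₀| ≤ 3 ^ τ.1 * σ.M₀ (I + 1) s τ := by
    intro i hi
    obtain ⟨z₀, hz₀, hle⟩ := hbs.hasse Λ hadm i hi s τ
    refine ⟨3 ^ τ.1 * z₀, ?_, ?_⟩
    · rw [eval_hasseDeriv_comp_third, ← mul_assoc, mul_comm (σ.den₀ (I + 1) s τ : ℚ), mul_assoc, hz₀]
      push_cast; ring
    · rw [abs_mul, abs_pow, abs_of_pos (by norm_num : (0 : ℤ) < 3)]
      exact mul_le_mul_of_nonneg_left hle (pow_nonneg (by norm_num) _)
  -- the virtual `qPart3` datum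
  have hm₃ := F.thirdDatum_of_vbox hUcol hvbox s
  have hDm₃ : 1 ≤ F.DmOf (SatData.W3 (Bv I) Ucol s) := F.one_le_DmOf _
  have hD : 1 ≤ thirdDenSat σ F Bv Ucol I s τ := by
    unfold thirdDenSat
    exact one_le_mul (one_le_mul (hfin.one_le_den₀ s τ) (Nat.one_le_pow _ _ (Int.natAbs_pos.mpr S.bθ_ne))) hDm₃
  have hden : ∀ r, ∃ z : ℤ, (thirdDenSat σ F Bv Ucol I s τ : ℚ) * S.thirdVec Λ.R Λ.u Λ.uθ Λ.B Λ.p τ s r = z := by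
    intro r
    obtain ⟨z, hz, _⟩ := S.exists_int_clear_mul_thirdVec_gen Λ.R Λ.u Λ.uθ Λ.B Λ.p τ s hR3 hadm.dir_le hadm.p_le hm₃ r
    exact ⟨z, hz⟩
  have hM : 1 ≤ thirdMSat σ F Bv Ucol I s τ := le_max_left _ _
  have hcM : ∑ r, |(S.thirdVec Λ.R Λ.u Λ.uθ Λ.B Λ.p τ s r : ℝ)| ≤ thirdMSat σ F Bv Ucol I s τ := by
    refine (S.sum_abs_thirdVec_le_gen Λ.R Λ.u Λ.uθ Λ.B Λ.p τ s (hfin.one_le_den₀ s τ) hR3 hadm.dir_le hadm.p_le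
      hDm₃ hm₃).trans (le_trans ?_ (le_max_right _ _))
    have hcard : (Λ.B.card : ℝ) ≤ σ.cardB I := by exact_mod_cast hadm.card_le
    have hP0 : (0 : ℝ) ≤ σ.P := by exact_mod_cast (abs_nonneg _).trans (hadm.p_le i hi)
    have hM0 : (0 : ℝ) ≤ σ.M₀ (I + 1) s τ := by
      obtain ⟨z₀, _, hle⟩ := hbs.hasse Λ hadm i hi s τ
      exact_mod_cast (abs_nonneg _).trans hle
    have hXb : (0 : ℝ) ≤ (σ.Xb I : ℝ) ^ (∑ j, τ.2 j) := by
      rcases Nat.eq_zero_or_pos (∑ j, τ.2 j) with h0 | hpos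
      · rw [h0, pow_zero]; exact zero_le_one
      · obtain ⟨j, -, hj⟩ := Finset.exists_ne_zero_of_sum_ne_zero (by omega : ∑ j, τ.2 j ≠ 0)
        have : (0 : ℤ) ≤ σ.Xb I := (abs_nonneg _).trans (hadm.dir_le i hi j)
        exact pow_nonneg (by exact_mod_cast this) _
    have hbr : (0 : ℝ) ≤ (3 : ℝ) ^ τ.1 * σ.M₀ (I + 1) s τ * (σ.Xb I : ℝ) ^ (∑ j, τ.2 j) *
        ((F.DmOf (SatData.W3 (Bv I) Ucol s) : ℝ)) ^ 2 := by positivity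
    have key := mul_le_mul_of_nonneg_right (mul_le_mul_of_nonneg_right hcard hP0) hbr
    push_cast at key ⊢
    linarith [key]
  have hzero : ∀ x : ℤ, |x| ≤ (σ.Nfin I : ℤ) → ∀ τ'' : Tau S.d, tauNorm τ'' < σ.Tfin I →
      S.g3φ Λ.R Λ.u Λ.uθ Λ.B Λ.p τ'' x = 0 := fun x hx τ'' hτ'' => hvan x hx trivial τ'' hτ''
  have hT0 := hfin.T0_succ_le
  have hτ' : tauNorm τ + (σ.Tfin I - σ.T0 (I + 1)) ≤ σ.Tfin I := by omega
  have hfinal := hfin.hfinal s hs h3 τ hτ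
  exact S.thirdVec_eq_zero_of_zeros Λ.R Λ.u Λ.uθ hK Λ.B Λ.p Λ.i₀ hadm.slab hfin.tthird_pos hBw0 hadm.wt
    hzero s τ hτ' hD hden hM hcM (by exact_mod_cast hfinal)

/-! ### Admissibility of the base-relative re-indexed family -/

/-- **The base-relative re-indexed class of an unknown with a nonzero coefficient is admissible at level `I + 1`**
(the landed `adm_reindex3R`, generic in the shape slot, on the Sat obligations). [cite: Yu2013, Lemma 5.4 and (5.1)(i); shape only] -/
theorem adm_reindex3RSat {I : ℕ} (hfin : ThirdFinalTwoRSat σ F Bv Ucol I) {Sh' : ℕ → S.G3Fam ι → Prop}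
    (hbs : BasisStepTwoR σ Sh' I) {Λ : S.G3Fam ι} (hadm : S.G3Adm σ Sh' I Λ) {i₁ : ι} (hi₁ : i₁ ∈ Λ.B)
    (hp₁ : Λ.p i₁ ≠ 0) : S.G3Adm σ Sh' (I + 1) (Λ.reindex3R i₁) := by
  set Λ' := Λ.reindex3R i₁ with hΛ'
  have hsub : ∀ i ∈ Λ'.B, i ∈ Λ.B := fun i hi => Λ.reindex3R_B_subset i₁ hi
  have hi₁' : i₁ ∈ Λ'.B := Λ.base_mem_reindex3R i₁ hi₁
  have hq1 : (C (3⁻¹ : ℚ) * X).natDegree = 1 := natDegree_C_mul_X _ (by norm_num)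
  have hdeg : ∀ i, (Λ'.R i).natDegree = (Λ.R i).natDegree := by
    intro i
    change ((Λ.R i).comp (C (3⁻¹ : ℚ) * X)).natDegree = _
    rw [natDegree_comp, hq1, mul_one]
  exact
    { card_le := (Finset.card_le_card (Λ.reindex3R_B_subset i₁)).trans (hadm.card_le.trans hfin.cardB_mono)
      exists_ne := ⟨i₁, hi₁', hp₁⟩
      deg_ne := by
        intro i hi i' hi' hκ hne
        rw [hdeg, hdeg]
        refine hadm.deg_ne i (hsub i hi) i' (hsub i' hi') ?_ hne
        funext k
        have hk := congrFun hκ k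
        unfold allκ at hk ⊢
        rw [Λ.snoc_eq_of_memR i₁ hi k, Λ.snoc_eq_of_memR i₁ hi' k]
        change (Fin.snoc (Λ'.u i) (Λ'.uθ i) : Fin (S.d + 1) → ℤ) k =
          (Fin.snoc (Λ'.u i') (Λ'.uθ i') : Fin (S.d + 1) → ℤ) k at hk
        rw [hk]
      R_ne := by
        intro i hi h0
        have hlc := leadingCoeff_comp (p := Λ.R i) (q := C (3⁻¹ : ℚ) * X) (by rw [hq1]; exact one_ne_zero)
        change (Λ.R i).comp (C (3⁻¹ : ℚ) * X) = 0 at h0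
        rw [h0, leadingCoeff_zero, leadingCoeff_C_mul_X] at hlc
        exact (mul_ne_zero (leadingCoeff_ne_zero.mpr (hadm.R_ne i (hsub i hi))) (pow_ne_zero _ (by norm_num)))
          hlc.symm
      deg_le := fun i hi => (hdeg i).le.trans (hadm.deg_le i (hsub i hi))
      p_le := fun i hi => hadm.p_le i (hsub i hi)
      u_le := fun i hi => (hbs.box Λ hadm i₁ hi₁ i hi).1
      uθ_le := fun i hi => (hbs.box Λ hadm i₁ hi₁ i hi).2
      dir_le := fun i hi j =>
        (S.abs_dirScalar_le (hbs.box Λ hadm i₁ hi₁ i hi).1 (hbs.box Λ hadm i₁ hi₁ i hi).2 j).trans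
          (hfin.Xb_succ j)
      slab := by
        intro i hi
        have hfun : ∀ i ∈ Λ'.B, Λ.u i = (fun j => 3 * Λ'.u i j + Λ.u i₁ j) ∧
            Λ.uθ i = 3 * Λ'.uθ i + Λ.uθ i₁ :=
          fun i hi => ⟨funext fun j => Λ.u_eq_of_memR i₁ hi j, Λ.uθ_eq_of_memR i₁ hi⟩
        have hz : ∀ i ∈ Λ'.B, S.zexpo (Λ.u i) (Λ.uθ i) =
            3 * S.zexpo (Λ'.u i) (Λ'.uθ i) + S.zexpo (Λ.u i₁) (Λ.uθ i₁) := by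
          intro i hi
          conv_lhs => rw [(hfun i hi).1, (hfun i hi).2]
          rw [S.zexpo_reindex3]
        have h0 : S.zexpo (Λ'.u i₁) (Λ'.uθ i₁) = 0 := by
          have hu0 : Λ'.u i₁ = fun _ => 0 := funext fun j => by
            change (Λ.u i₁ j - Λ.u i₁ j) / 3 = 0; simp
          have hθ0 : Λ'.uθ i₁ = 0 := by change (Λ.uθ i₁ - Λ.uθ i₁) / 3 = 0; simp
          rw [hu0, hθ0]
          unfold zexpo zγ
          simp
        have e : S.δexpo Λ'.u Λ'.uθ i₁ i =
            (3 : ℚ_[2])⁻¹ * (S.δexpo Λ.u Λ.uθ Λ.i₀ i - S.δexpo Λ.u Λ.uθ Λ.i₀ i₁) := by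
          unfold δexpo
          rw [hz i hi, hz i₁ hi₁', h0]
          field_simp
          ring
        change ‖S.δexpo Λ'.u Λ'.uθ i₁ i‖ ≤ _
        rw [e, norm_mul, norm_inv, norm_three_two, inv_one, one_mul, sub_eq_add_neg]
        exact (IsUltrametricDist.norm_add_le_max _ _).trans
          (max_le (hadm.slab i (hsub i hi)) (by rw [norm_neg]; exact hadm.slab i₁ hi₁))
      wt := by
        intro i hi t₀ k
        change ‖(hw (fun i => (Λ.R i).comp (C (3⁻¹ : ℚ) * X)) i t₀).coeff k‖ * _ ≤ _
        rw [norm_coeff_hw_comp_third]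
        exact (hadm.wt i (hsub i hi) t₀ k).trans hfin.Bw_mono
      hasse := fun i hi x τ => hbs.hasse Λ hadm i (hsub i hi) x τ
      shape := hbs.shape Λ hadm i₁ hi₁ }

/-! ### The third step (Sat) -/

/-- **THE THIRD STEP OF THE LEVEL INDUCTION ON THE 𝔑-THREADED FAMILY**: `ThirdStepTwo σ (ShSat F Bv Sh) I` from
`ThirdFinalTwoRSat`, `BasisStepTwoR σ (ShSat F Bv Sh) I`, the basis slot `Σₖ |U k j| ≤ Ucolⱼ` and the `3`-Kummer
condition on the generators. [cite: Yu2013, Lemmas 5.3–5.4] [cite: Nesterenko2003, §4.3] -/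
theorem thirdStepTwo_ofRSat {I : ℕ} (hfin : ThirdFinalTwoRSat σ F Bv Ucol I)
    (hbs : BasisStepTwoR σ (ShSat F Bv Sh) I) (hUcol : ∀ j, ∑ k, |F.U k j| ≤ (Ucol j : ℤ))
    (hK : ∀ κ : Fin (S.d + 1) → ℕ, (∃ j, ¬ 3 ∣ κ j) → ∀ γ : ℚ, ∏ j, S.toQ.all j ^ κ j ≠ γ ^ 3) :
    ThirdStepTwo σ (ShSat F Bv Sh) I := by
  intro Λ hadm hvan
  obtain ⟨i₁, hi₁, hp₁⟩ := hadm.exists_ne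
  refine ⟨Λ.reindex3R i₁, adm_reindex3RSat σ F Bv Ucol hfin hbs hadm hi₁ hp₁, ?_⟩
  exact S.vanish_cop_reindex3R Λ (thirdVec_eq_zero_of_admRSat σ F Bv Ucol Sh hfin hbs hUcol hK hadm hvan) i₁

end TwoSetup

end Summit.ABC.StewartYu

end
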